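import Mathlib
import HarnessLib
import Summits.HubbardSuperconductivity.HubbardSuperconductivity.Theorems.KLProgrammeKLRegimeSplitThermalLayerExt

/-!
# Route `KLProgramme` — crux K3 split, ENGINE child (`KLRegimeEngineV7` stmt-HubbardSuperconductivity-19662 and its gen-3 successor):
# the single-slice radial propagator in the `(k₀, e)` plane, the SIGN-BLIND discrete Matsubara sum over a box, and the generic
# TRANSFER PERTURBATION of a discrete bubble (cell gate-hubbard-kl, seat hubbard-kl-k3c2-p2 «thermal-bar induction n ≤ nScales β + 1»)

WHY.  The particle–hole gain profile of the engine package (`phGainOf C₀ K C₁ C₂ w e₀ n m ρ`, `…ShellGainProfiles`, p1 g6; `klEngGeo.phGain`)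
has a «below-resolution» branch `C₀4^{-n} + K·(ρ + w4^{-m})/Λ_n`: the zero-sound remainder `C₀4^{-n}` (the same-slice bubble at ZERO transfer —
`…MatsubaraZeroSound*`, `klte_slice_bubble_weighted_norm_le`) plus a term LIPSCHITZ IN THE TRANSFER, `K·ρ/Λ_n`: the bubble at transfer
`(q₀, q)` minus the bubble at transfer `0`.  In the frame coordinates `(θ, e)` of the slice the shifted line carries frequency `k₀ + q₀` and
energy `e_K(k(θ,e) + q) = e + δ(e)` with `|δ| ≤ ‖∇e_K‖·|q|`; the exchange channel of the pair amplitude at the reading frequencies `±ω₀` has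
`q₀ = 2π/β`, so the same estimate also produces a «temperature / scale» term `(2π/β)/Λ_n` — thermal-shaped (`klte_ratio_mul_le_thermalBar`).
This module supplies the sign-blind layer of that estimate (no cancellation is used):
* §1 the SIGN-BLIND DISCRETE SUM: `h : ℝ → ℝ → E` with `‖h‖ ≤ B`, vanishing for `|k₀| ≥ r` and for `|e| ≥ r` ⇒
  `‖β⁻¹ • Σ_{i : MatsubaraIdx M} ∫ h(ω_i, e) de‖ ≤ (r/π + 3/β)·2rB` (every `M`, every `β > 0`; the tree's `card_filter_matsubaraFreq_le`);
* §2 the TRANSFER PERTURBATION, generic: `Φ` bounded by `A` and supported in the box `|k₀|, |e| < r`, `Ψ` jointly `K`-Lipschitz, `‖W‖ ≤ B_W` on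
  `|e| < r`, `|δ| ≤ δ_max` ⇒ `‖β⁻¹ • Σ_i ∫ W(e)·Φ(ω_i,e)·(Ψ(ω_i+q₀, e+δ(e)) − Ψ(ω_i,e)) de‖ ≤ (r/π + 3/β)·2r·B_W·A·K·(|q₀| + δ_max)`;
* §3 the INSTANCE: the single-slice radial propagator in singularity-free form `Φ_g(k₀,e) = g(k₀²+e²)·(ik₀+e)` (`= f(s)·(−ik₀+e)⁻¹` for
  `f = g·s`, `klsp_propagator_eq`) with `g` `L`-Lipschitz, `‖g‖ ≤ M_g`, `g(s) = 0` for `s ≥ r²`: support in the box, `‖Φ_g‖ ≤ M_g·r`, the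
  JOINT LIPSCHITZ bound `‖Φ_g(k₀,e) − Φ_g(k₀',e')‖ ≤ (3Lr² + M_g)·(|k₀−k₀'| + |e−e'|)` on the whole plane, and continuity in `e`.
The dictionary from the shell weight `f` to `g = f/s` and the scale forms at `n ≤ n_β + 1` are in `…MatsubaraSliceBubbleTransfer`.
Pure analysis; nothing about the model is asserted.  The step prover supplies `W` (frame Jacobian × LOCAL couplings), `δ` and the constants.
References: DECOMP App. E Lemma E.2 (iii)/(iv)(a); `…ShellGainProfiles` (`phGainOf`); BGM 2006 §2.5; HOME/hubbard-kl-k3c2-p2/THERMAL-NOTE.md.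
-/

noncomputable section

namespace Summit.HubbardSuperconductivity.HubbardSuperconductivity.Theorems.KLRegimeSplit

set_option linter.dupNamespace false -- summit = problem name (single-conjunct summit), D-0017

open Real Finset MeasureTheory Complex Literature.MathematicalPhysics.QuantumLattice Literature.Probability.LatticeModels
open Summit.HubbardSuperconductivity.HubbardSuperconductivity.Theorems.KLProgrammeLegKernels

/-! ## §1 The sign-blind discrete Matsubara sum over a box -/

section SignBlind

variable {E : Type*} [NormedAddCommGroup E] [NormedSpace ℝ E]

/-- `r ≤ |e|` off the interval `[-r, r]`. -/
theorem klsp_le_abs_of_not_mem_Icc {r e : ℝ} (he : e ∉ Set.Icc (-r) r) : r ≤ |e| := by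
  rw [Set.mem_Icc, not_and_or, not_le, not_le] at he
  rcases he with h | h
  · exact le_trans (by linarith) (neg_le_abs e)
  · exact le_trans h.le (le_abs_self e)

/-- One slice: a function bounded by `B` and vanishing for `|e| ≥ r` (`r ≥ 0`) has `‖∫ h‖ ≤ 2rB` (no measurability needed). -/
theorem klsp_norm_integral_slice_le {h : ℝ → E} {B r : ℝ} (hr : 0 ≤ r) (hbd : ∀ e, ‖h e‖ ≤ B)
    (hzero : ∀ e, r ≤ |e| → h e = 0) : ‖∫ e, h e‖ ≤ 2 * r * B := by
  have hbound : ∀ e : ℝ, ‖h e‖ ≤ Set.indicator (Set.Icc (-r) r) (fun _ => B) e := by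
    intro e
    by_cases he : e ∈ Set.Icc (-r) r
    · rw [Set.indicator_of_mem he]; exact hbd e
    · rw [Set.indicator_of_notMem he, hzero e (klsp_le_abs_of_not_mem_Icc he), norm_zero]
  have hind : Integrable (Set.indicator (Set.Icc (-r) r) (fun _ : ℝ => B)) := by
    refine IntegrableOn.integrable_indicator ?_ measurableSet_Icc
    exact integrableOn_const (by rw [Real.volume_Icc]; exact ENNReal.ofReal_ne_top)
  calc ‖∫ e, h e‖ ≤ ∫ e, Set.indicator (Set.Icc (-r) r) (fun _ => B) e :=
        norm_integral_le_of_norm_le hind (Filter.Eventually.of_forall hbound)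
    _ = (volume (Set.Icc (-r) r)).toReal * B := by rw [integral_indicator_const _ measurableSet_Icc, smul_eq_mul, Measure.real]
    _ = 2 * r * B := by rw [Real.volume_Icc, ENNReal.toReal_ofReal (by linarith)]; ring

/-- **The sign-blind discrete Matsubara sum over a box.**  `h : ℝ → ℝ → E` with `‖h(k₀,e)‖ ≤ B`, `h(k₀,e) = 0` for `|k₀| ≥ r` and for
`|e| ≥ r` (`B, r ≥ 0`), `β > 0`, any Matsubara cutoff `M`:
`‖β⁻¹ • Σ_{i : MatsubaraIdx M} ∫ h(ω_i, e) de‖ ≤ (r/π + 3/β)·(2rB)` — at most `rβ/π + 3` kept frequencies lie in `|k₀| < r`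
(`card_filter_matsubaraFreq_le`), each slice costs `2rB`. -/
theorem klsp_discrete_sum_norm_le {h : ℝ → ℝ → E} {B r : ℝ} (hB : 0 ≤ B) (hr : 0 ≤ r)
    (hbd : ∀ k₀ e, ‖h k₀ e‖ ≤ B) (hfst : ∀ k₀, r ≤ |k₀| → ∀ e, h k₀ e = 0) (hsnd : ∀ k₀ e, r ≤ |e| → h k₀ e = 0)
    {β : ℝ} (hβ : 0 < β) (M : ℕ) :
    ‖β⁻¹ • ∑ i : MatsubaraIdx M, ∫ e, h (matsubaraFreq β M i) e‖ ≤ (r / Real.pi + 3 / β) * (2 * r * B) := by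
  set ω : MatsubaraIdx M → ℝ := fun i => matsubaraFreq β M i with hω
  -- each term: `2rB` if `|ω_i| < r`, else `0`
  have hterm : ∀ i : MatsubaraIdx M, ‖∫ e, h (ω i) e‖ ≤ if |ω i| < r then 2 * r * B else 0 := by
    intro i
    split_ifs with hi
    · exact klsp_norm_integral_slice_le hr (fun e => hbd _ e) (fun e he => hsnd _ e he)
    · simp_rw [hfst (ω i) (not_lt.mp hi)]
      rw [integral_zero, norm_zero]
  have hcard := card_filter_matsubaraFreq_le hβ hr (Finset.univ.filter fun i : MatsubaraIdx M => |ω i| < r)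
    (fun i hi => ((Finset.mem_filter.mp hi).2).le)
  have hsum : ∑ i : MatsubaraIdx M, (if |ω i| < r then 2 * r * B else 0) =
      ((Finset.univ.filter fun i : MatsubaraIdx M => |ω i| < r).card : ℝ) * (2 * r * B) := by
    rw [Finset.sum_ite, Finset.sum_const_zero, add_zero, Finset.sum_const, nsmul_eq_mul]
  calc ‖β⁻¹ • ∑ i : MatsubaraIdx M, ∫ e, h (ω i) e‖
      = β⁻¹ * ‖∑ i : MatsubaraIdx M, ∫ e, h (ω i) e‖ := by
        rw [norm_smul, norm_inv, Real.norm_of_nonneg hβ.le]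
    _ ≤ β⁻¹ * ∑ i : MatsubaraIdx M, ‖∫ e, h (ω i) e‖ :=
        mul_le_mul_of_nonneg_left (norm_sum_le _ _) (inv_nonneg.mpr hβ.le)
    _ ≤ β⁻¹ * ∑ i : MatsubaraIdx M, (if |ω i| < r then 2 * r * B else 0) :=
        mul_le_mul_of_nonneg_left (Finset.sum_le_sum fun i _ => hterm i) (inv_nonneg.mpr hβ.le)
    _ = β⁻¹ * (((Finset.univ.filter fun i : MatsubaraIdx M => |ω i| < r).card : ℝ) * (2 * r * B)) := by rw [hsum]
    _ ≤ β⁻¹ * ((r * β / Real.pi + 3) * (2 * r * B)) :=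
        mul_le_mul_of_nonneg_left (mul_le_mul_of_nonneg_right hcard (by positivity)) (inv_nonneg.mpr hβ.le)
    _ = (r / Real.pi + 3 / β) * (2 * r * B) := by field_simp

end SignBlind

/-! ## §2 The transfer perturbation, generic -/

section Perturb

variable {Φ Ψ : ℝ → ℝ → ℂ} {W : ℝ → ℂ} {δ : ℝ → ℝ} {A K BW r δmax : ℝ}

/-- Pointwise: `‖W(e)·Φ(k₀,e)·(Ψ(k₀+q₀, e+δ(e)) − Ψ(k₀,e))‖ ≤ B_W·A·K·(|q₀| + δ_max)` (where `Φ ≠ 0` the weight bound applies; `Ψ` jointly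
`K`-Lipschitz). -/
theorem klsp_perturb_pointwise (hA : 0 ≤ A) (hK : 0 ≤ K) (hBW : 0 ≤ BW) (hδ0 : 0 ≤ δmax)
    (hΦbd : ∀ k₀ e, ‖Φ k₀ e‖ ≤ A) (hΦsnd : ∀ k₀ e, r ≤ |e| → Φ k₀ e = 0)
    (hΨlip : ∀ k₀ e k₀' e', ‖Ψ k₀ e - Ψ k₀' e'‖ ≤ K * (|k₀ - k₀'| + |e - e'|))
    (hWbd : ∀ e, |e| < r → ‖W e‖ ≤ BW) (hδ : ∀ e, |δ e| ≤ δmax) (q₀ k₀ e : ℝ) :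
    ‖W e * Φ k₀ e * (Ψ (k₀ + q₀) (e + δ e) - Ψ k₀ e)‖ ≤ BW * A * (K * (|q₀| + δmax)) := by
  by_cases he : |e| < r
  · rw [norm_mul, norm_mul]
    have h1 : ‖Ψ (k₀ + q₀) (e + δ e) - Ψ k₀ e‖ ≤ K * (|q₀| + δmax) := by
      refine (hΨlip _ _ _ _).trans ?_
      rw [show k₀ + q₀ - k₀ = q₀ by ring, show e + δ e - e = δ e by ring]
      exact mul_le_mul_of_nonneg_left (by linarith [hδ e]) hK
    have h0 : 0 ≤ K * (|q₀| + δmax) := by positivity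
    exact mul_le_mul (mul_le_mul (hWbd e he) (hΦbd k₀ e) (norm_nonneg _) hBW) h1 (norm_nonneg _) (by positivity)
  · rw [hΦsnd k₀ e (not_lt.mp he), mul_zero, zero_mul, norm_zero]
    positivity

/-- **The transfer perturbation of the discrete bubble, generic form.**  `Φ : ℝ → ℝ → ℂ` bounded by `A` with `Φ(k₀,e) = 0` for `|k₀| ≥ r`
and for `|e| ≥ r`; `Ψ : ℝ → ℝ → ℂ` jointly `K`-Lipschitz (`‖Ψ(k₀,e) − Ψ(k₀',e')‖ ≤ K(|k₀−k₀'| + |e−e'|)`); `‖W(e)‖ ≤ B_W` for `|e| < r`;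
a shift `δ : ℝ → ℝ` with `|δ| ≤ δ_max`; `A, K, B_W, r, δ_max ≥ 0`, `β > 0`, any `M`, any `q₀`.  Then
`‖β⁻¹ • Σ_{i : MatsubaraIdx M} ∫ W(e)·Φ(ω_i,e)·(Ψ(ω_i + q₀, e + δ(e)) − Ψ(ω_i, e)) de‖ ≤ (r/π + 3/β)·(2r·(B_W·A·(K·(|q₀| + δ_max))))`. -/
theorem klsp_discrete_perturb_norm_le (hA : 0 ≤ A) (hK : 0 ≤ K) (hBW : 0 ≤ BW) (hr : 0 ≤ r) (hδ0 : 0 ≤ δmax)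
    (hΦbd : ∀ k₀ e, ‖Φ k₀ e‖ ≤ A) (hΦfst : ∀ k₀, r ≤ |k₀| → ∀ e, Φ k₀ e = 0) (hΦsnd : ∀ k₀ e, r ≤ |e| → Φ k₀ e = 0)
    (hΨlip : ∀ k₀ e k₀' e', ‖Ψ k₀ e - Ψ k₀' e'‖ ≤ K * (|k₀ - k₀'| + |e - e'|))
    (hWbd : ∀ e, |e| < r → ‖W e‖ ≤ BW) (hδ : ∀ e, |δ e| ≤ δmax) (q₀ : ℝ) {β : ℝ} (hβ : 0 < β) (M : ℕ) :
    ‖β⁻¹ • ∑ i : MatsubaraIdx M,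
        ∫ e, W e * Φ (matsubaraFreq β M i) e * (Ψ (matsubaraFreq β M i + q₀) (e + δ e) - Ψ (matsubaraFreq β M i) e)‖ ≤
      (r / Real.pi + 3 / β) * (2 * r * (BW * A * (K * (|q₀| + δmax)))) := by
  refine klsp_discrete_sum_norm_le (h := fun k₀ e => W e * Φ k₀ e * (Ψ (k₀ + q₀) (e + δ e) - Ψ k₀ e)) (by positivity) hr
    (fun k₀ e => klsp_perturb_pointwise hA hK hBW hδ0 hΦbd hΦsnd hΨlip hWbd hδ q₀ k₀ e) ?_ ?_ hβ M
  · intro k₀ hk e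
    simp only [hΦfst k₀ hk e, mul_zero, zero_mul]
  · intro k₀ e he
    simp only [hΦsnd k₀ e he, mul_zero, zero_mul]

end Perturb

/-! ## §3 The instance: the single-slice radial propagator `Φ_g(k₀,e) = g(k₀²+e²)·(ik₀+e)` -/

section Propagator

variable {g : ℝ → ℂ} {L Mg r : ℝ}

/-- **The two forms of the slice propagator agree**: `g(s)·(ik₀+e) = (g(s)·s)·(−ik₀+e)⁻¹`, `s = k₀² + e²` (also at `s = 0`, where both
vanish by `0⁻¹ = 0`): with `f = g·s` the shell weight, `Φ_g` IS the propagator `f(k₀²+e_K²)/(−ik₀+e_K)` of the slice. -/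
theorem klsp_propagator_eq (g : ℝ → ℂ) (k₀ e : ℝ) :
    g (k₀ ^ 2 + e ^ 2) * (I * k₀ + e) = (g (k₀ ^ 2 + e ^ 2) * ((k₀ ^ 2 + e ^ 2 : ℝ) : ℂ)) * (-I * k₀ + e)⁻¹ := by
  by_cases hz : (-I * k₀ + e : ℂ) = 0
  · have hre := congrArg Complex.re hz
    have him := congrArg Complex.im hz
    simp at hre him
    subst hre; subst him
    simp
  · have hprod : (I * k₀ + e : ℂ) * (-I * k₀ + e) = ((k₀ ^ 2 + e ^ 2 : ℝ) : ℂ) := by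
      push_cast; ring_nf; rw [Complex.I_sq]; ring
    rw [eq_mul_inv_iff_mul_eq₀ hz, ← hprod]
    ring

/-- Off the disc the propagator vanishes: `r ≤ |k₀|` … -/
theorem klsp_zero_of_le_abs_fst (hsupp : ∀ s, r ^ 2 ≤ s → g s = 0) (hr : 0 ≤ r) {k₀ : ℝ} (hk : r ≤ |k₀|) (e : ℝ) :
    g (k₀ ^ 2 + e ^ 2) * (I * k₀ + e) = 0 := by
  have : r ^ 2 ≤ k₀ ^ 2 + e ^ 2 := by nlinarith [sq_abs k₀, sq_nonneg e, abs_nonneg k₀]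
  rw [hsupp _ this, zero_mul]

/-- … or `r ≤ |e|`. -/
theorem klsp_zero_of_le_abs_snd (hsupp : ∀ s, r ^ 2 ≤ s → g s = 0) (hr : 0 ≤ r) (k₀ : ℝ) {e : ℝ} (he : r ≤ |e|) :
    g (k₀ ^ 2 + e ^ 2) * (I * k₀ + e) = 0 := by
  have : r ^ 2 ≤ k₀ ^ 2 + e ^ 2 := by nlinarith [sq_abs e, sq_nonneg k₀, abs_nonneg e]
  rw [hsupp _ this, zero_mul]

/-- **Sup bound**: `‖Φ_g(k₀,e)‖ ≤ M_g·r` (`‖g‖ ≤ M_g`, support radius `r ≥ 0`). -/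
theorem klsp_norm_le (hbd : ∀ s, ‖g s‖ ≤ Mg) (hsupp : ∀ s, r ^ 2 ≤ s → g s = 0) (hr : 0 ≤ r) (k₀ e : ℝ) :
    ‖g (k₀ ^ 2 + e ^ 2) * (I * k₀ + e)‖ ≤ Mg * r := by
  have hMg : 0 ≤ Mg := (norm_nonneg _).trans (hbd 0)
  rcases lt_or_ge (k₀ ^ 2 + e ^ 2) (r ^ 2) with hs | hs
  · rw [norm_mul, klzd_norm_lin]
    have : Real.sqrt (k₀ ^ 2 + e ^ 2) ≤ r := by
      rw [Real.sqrt_le_left hr]; exact hs.le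
    exact mul_le_mul (hbd _) this (Real.sqrt_nonneg _) hMg
  · rw [hsupp _ hs, zero_mul, norm_zero]; positivity

/-- Auxiliary (the mixed case of the joint Lipschitz estimate): if `k₀² + e² < r² ≤ k₀'² + e'²` then
`‖Φ_g(k₀,e)‖ ≤ (3Lr² + M_g)·(|k₀ − k₀'| + |e − e'|)`. -/
theorem klsp_lipschitz_aux (hlip : ∀ s s', ‖g s - g s'‖ ≤ L * |s - s'|) (hbd : ∀ s, ‖g s‖ ≤ Mg)
    (hsupp : ∀ s, r ^ 2 ≤ s → g s = 0) (hr : 0 < r)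
    {k₀ e k₀' e' : ℝ} (hs : k₀ ^ 2 + e ^ 2 < r ^ 2) (hs' : r ^ 2 ≤ k₀' ^ 2 + e' ^ 2) :
    ‖g (k₀ ^ 2 + e ^ 2) * (I * k₀ + e)‖ ≤ (3 * L * r ^ 2 + Mg) * (|k₀ - k₀'| + |e - e'|) := by
  have hL : 0 ≤ L := by
    have := hlip 0 1; have h0 : (0:ℝ) ≤ ‖g 0 - g 1‖ := norm_nonneg _; norm_num at this; linarith
  have hMg : 0 ≤ Mg := (norm_nonneg _).trans (hbd 0)
  have hk : |k₀| < r := by nlinarith [sq_abs k₀, sq_nonneg e, abs_nonneg k₀]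
  have he : |e| < r := by nlinarith [sq_abs e, sq_nonneg k₀, abs_nonneg e]
  have hD : 0 ≤ |k₀ - k₀'| + |e - e'| := by positivity
  -- the norm of the linear factor is `< r`
  have hz : ‖(I * k₀ + e : ℂ)‖ ≤ r := by
    rw [klzd_norm_lin, Real.sqrt_le_left hr.le]; exact hs.le
  -- `‖g s‖ ≤ L (s' − s)` (g vanishes at s')
  have hG1 : ‖g (k₀ ^ 2 + e ^ 2)‖ ≤ L * ((k₀' ^ 2 + e' ^ 2) - (k₀ ^ 2 + e ^ 2)) := by
    have := hlip (k₀ ^ 2 + e ^ 2) (k₀' ^ 2 + e' ^ 2)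
    rw [hsupp _ hs', sub_zero] at this
    refine this.trans (le_of_eq ?_)
    rw [abs_of_nonpos (by linarith)]; ring
  rw [norm_mul]
  by_cases hnear : |k₀'| ≤ 2 * r ∧ |e'| ≤ 2 * r
  · -- `s' − s ≤ 3r(|Δk| + |Δe|)`
    obtain ⟨hk', he'⟩ := hnear
    have h1 : (k₀' ^ 2 + e' ^ 2) - (k₀ ^ 2 + e ^ 2) ≤ 3 * r * (|k₀ - k₀'| + |e - e'|) := by
      have hA : k₀' ^ 2 - k₀ ^ 2 ≤ 3 * r * |k₀ - k₀'| := by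
        have : k₀' ^ 2 - k₀ ^ 2 = (k₀' + k₀) * (k₀' - k₀) := by ring
        rw [this]
        calc (k₀' + k₀) * (k₀' - k₀) ≤ |(k₀' + k₀) * (k₀' - k₀)| := le_abs_self _
          _ = |k₀' + k₀| * |k₀ - k₀'| := by rw [abs_mul, abs_sub_comm]
          _ ≤ 3 * r * |k₀ - k₀'| := by
              refine mul_le_mul_of_nonneg_right ?_ (abs_nonneg _)
              exact (abs_add_le _ _).trans (by linarith [hk.le])
      have hB : e' ^ 2 - e ^ 2 ≤ 3 * r * |e - e'| := by
        have : e' ^ 2 - e ^ 2 = (e' + e) * (e' - e) := by ring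
        rw [this]
        calc (e' + e) * (e' - e) ≤ |(e' + e) * (e' - e)| := le_abs_self _
          _ = |e' + e| * |e - e'| := by rw [abs_mul, abs_sub_comm]
          _ ≤ 3 * r * |e - e'| := by
              refine mul_le_mul_of_nonneg_right ?_ (abs_nonneg _)
              exact (abs_add_le _ _).trans (by linarith [he.le])
      linarith
    calc ‖g (k₀ ^ 2 + e ^ 2)‖ * ‖(I * k₀ + e : ℂ)‖ ≤ L * (3 * r * (|k₀ - k₀'| + |e - e'|)) * r :=
          mul_le_mul (hG1.trans (mul_le_mul_of_nonneg_left h1 hL)) hz (norm_nonneg _) (by positivity)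
      _ = 3 * L * r ^ 2 * (|k₀ - k₀'| + |e - e'|) := by ring
      _ ≤ (3 * L * r ^ 2 + Mg) * (|k₀ - k₀'| + |e - e'|) := by
          have h3 : 0 ≤ Mg * (|k₀ - k₀'| + |e - e'|) := by positivity
          have hring : (3 * L * r ^ 2 + Mg) * (|k₀ - k₀'| + |e - e'|) =
              3 * L * r ^ 2 * (|k₀ - k₀'| + |e - e'|) + Mg * (|k₀ - k₀'| + |e - e'|) := by ring
          linarith
  · -- far: `|Δk| + |Δe| ≥ r`
    have h1 : r ≤ |k₀ - k₀'| + |e - e'| := by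
      rw [not_and_or, not_le, not_le] at hnear
      rcases hnear with h | h
      · have := abs_sub_abs_le_abs_sub k₀' k₀
        rw [abs_sub_comm] at this
        linarith [hk.le, abs_nonneg (e - e')]
      · have := abs_sub_abs_le_abs_sub e' e
        rw [abs_sub_comm] at this
        linarith [he.le, abs_nonneg (k₀ - k₀')]
    calc ‖g (k₀ ^ 2 + e ^ 2)‖ * ‖(I * k₀ + e : ℂ)‖ ≤ Mg * r := mul_le_mul (hbd _) hz (norm_nonneg _) hMg
      _ ≤ Mg * (|k₀ - k₀'| + |e - e'|) := mul_le_mul_of_nonneg_left h1 hMg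
      _ ≤ (3 * L * r ^ 2 + Mg) * (|k₀ - k₀'| + |e - e'|) := by
          have h3 : 0 ≤ 3 * L * r ^ 2 * (|k₀ - k₀'| + |e - e'|) := by positivity
          have hring : (3 * L * r ^ 2 + Mg) * (|k₀ - k₀'| + |e - e'|) =
              3 * L * r ^ 2 * (|k₀ - k₀'| + |e - e'|) + Mg * (|k₀ - k₀'| + |e - e'|) := by ring
          linarith

/-- **Joint Lipschitz bound of the slice propagator**: for `g` `L`-Lipschitz, `‖g‖ ≤ M_g`, `g(s) = 0` for `s ≥ r²` (`r > 0`):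
`‖Φ_g(k₀,e) − Φ_g(k₀',e')‖ ≤ (3Lr² + M_g)·(|k₀ − k₀'| + |e − e'|)` on the whole plane. -/
theorem klsp_lipschitz (hlip : ∀ s s', ‖g s - g s'‖ ≤ L * |s - s'|) (hbd : ∀ s, ‖g s‖ ≤ Mg)
    (hsupp : ∀ s, r ^ 2 ≤ s → g s = 0) (hr : 0 < r) (k₀ e k₀' e' : ℝ) :
    ‖g (k₀ ^ 2 + e ^ 2) * (I * k₀ + e) - g (k₀' ^ 2 + e' ^ 2) * (I * k₀' + e')‖ ≤
      (3 * L * r ^ 2 + Mg) * (|k₀ - k₀'| + |e - e'|) := by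
  have hL : 0 ≤ L := by
    have := hlip 0 1; have h0 : (0:ℝ) ≤ ‖g 0 - g 1‖ := norm_nonneg _; norm_num at this; linarith
  have hMg : 0 ≤ Mg := (norm_nonneg _).trans (hbd 0)
  have h0 : 0 ≤ (3 * L * r ^ 2 + Mg) * (|k₀ - k₀'| + |e - e'|) := by positivity
  by_cases hs : k₀ ^ 2 + e ^ 2 < r ^ 2 <;> by_cases hs' : k₀' ^ 2 + e' ^ 2 < r ^ 2
  · -- both inside the disc
    have hk : |k₀| < r := by nlinarith [sq_abs k₀, sq_nonneg e, abs_nonneg k₀]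
    have hk' : |k₀'| < r := by nlinarith [sq_abs k₀', sq_nonneg e', abs_nonneg k₀']
    have he : |e| < r := by nlinarith [sq_abs e, sq_nonneg k₀, abs_nonneg e]
    have he' : |e'| < r := by nlinarith [sq_abs e', sq_nonneg k₀', abs_nonneg e']
    set z : ℂ := I * k₀ + e with hz
    set z' : ℂ := I * k₀' + e' with hz'
    have hzn : ‖z‖ ≤ r := by
      rw [hz, klzd_norm_lin, Real.sqrt_le_left hr.le]; exact hs.le
    have hdiff : z - z' = I * ((k₀ - k₀' : ℝ) : ℂ) + ((e - e' : ℝ) : ℂ) := by rw [hz, hz']; push_cast; ring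
    have hndiff : ‖z - z'‖ ≤ |k₀ - k₀'| + |e - e'| := by
      rw [hdiff]
      refine (norm_add_le _ _).trans ?_
      rw [norm_mul, Complex.norm_I, one_mul, Complex.norm_real, Complex.norm_real, Real.norm_eq_abs, Real.norm_eq_abs]
    have hsdiff : |k₀ ^ 2 + e ^ 2 - (k₀' ^ 2 + e' ^ 2)| ≤ 2 * r * (|k₀ - k₀'| + |e - e'|) := by
      have : k₀ ^ 2 + e ^ 2 - (k₀' ^ 2 + e' ^ 2) = (k₀ + k₀') * (k₀ - k₀') + (e + e') * (e - e') := by ring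
      rw [this]
      refine (abs_add_le _ _).trans ?_
      rw [abs_mul, abs_mul]
      have hA : |k₀ + k₀'| ≤ 2 * r := (abs_add_le _ _).trans (by linarith)
      have hB : |e + e'| ≤ 2 * r := (abs_add_le _ _).trans (by linarith)
      nlinarith [abs_nonneg (k₀ - k₀'), abs_nonneg (e - e'), abs_nonneg (k₀ + k₀'), abs_nonneg (e + e')]
    -- split: (g s − g s') z + g s' (z − z')
    have hsplit : g (k₀ ^ 2 + e ^ 2) * z - g (k₀' ^ 2 + e' ^ 2) * z' =
        (g (k₀ ^ 2 + e ^ 2) - g (k₀' ^ 2 + e' ^ 2)) * z + g (k₀' ^ 2 + e' ^ 2) * (z - z') := by ring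
    rw [hsplit]
    have hA : ‖(g (k₀ ^ 2 + e ^ 2) - g (k₀' ^ 2 + e' ^ 2)) * z‖ ≤ 2 * L * r ^ 2 * (|k₀ - k₀'| + |e - e'|) := by
      rw [norm_mul]
      calc ‖g (k₀ ^ 2 + e ^ 2) - g (k₀' ^ 2 + e' ^ 2)‖ * ‖z‖ ≤ (L * (2 * r * (|k₀ - k₀'| + |e - e'|))) * r :=
            mul_le_mul ((hlip _ _).trans (mul_le_mul_of_nonneg_left hsdiff hL)) hzn (norm_nonneg _) (by positivity)
        _ = 2 * L * r ^ 2 * (|k₀ - k₀'| + |e - e'|) := by ring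
    have hB : ‖g (k₀' ^ 2 + e' ^ 2) * (z - z')‖ ≤ Mg * (|k₀ - k₀'| + |e - e'|) := by
      rw [norm_mul]
      exact mul_le_mul (hbd _) hndiff (norm_nonneg _) hMg
    calc _ ≤ ‖(g (k₀ ^ 2 + e ^ 2) - g (k₀' ^ 2 + e' ^ 2)) * z‖ + ‖g (k₀' ^ 2 + e' ^ 2) * (z - z')‖ := norm_add_le _ _
      _ ≤ 2 * L * r ^ 2 * (|k₀ - k₀'| + |e - e'|) + Mg * (|k₀ - k₀'| + |e - e'|) := add_le_add hA hB
      _ ≤ (3 * L * r ^ 2 + Mg) * (|k₀ - k₀'| + |e - e'|) := by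
          have : 0 ≤ L * r ^ 2 * (|k₀ - k₀'| + |e - e'|) := by positivity
          nlinarith
  · -- inside / outside
    rw [hsupp _ (not_lt.mp hs'), zero_mul, sub_zero]
    exact klsp_lipschitz_aux hlip hbd hsupp hr hs (not_lt.mp hs')
  · -- outside / inside
    rw [hsupp _ (not_lt.mp hs), zero_mul, zero_sub, norm_neg]
    have h1 := klsp_lipschitz_aux hlip hbd hsupp hr hs' (not_lt.mp hs)
    rwa [abs_sub_comm k₀' k₀, abs_sub_comm e' e] at h1
  · -- both outside
    rw [hsupp _ (not_lt.mp hs), hsupp _ (not_lt.mp hs'), zero_mul, zero_mul, sub_zero, norm_zero]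
    exact h0

end Propagator

/-! ### Continuity in `e` -/

section Continuity

/-- The slice propagator `e ↦ Φ_g(k₀, e)` is continuous (it is Lipschitz). -/
theorem klsp_continuous_snd {g : ℝ → ℂ} {L Mg r : ℝ} (hlip : ∀ s s', ‖g s - g s'‖ ≤ L * |s - s'|) (hbd : ∀ s, ‖g s‖ ≤ Mg)
    (hsupp : ∀ s, r ^ 2 ≤ s → g s = 0) (hr : 0 < r) (k₀ : ℝ) :
    Continuous fun e : ℝ => g (k₀ ^ 2 + e ^ 2) * (I * k₀ + e) := by
  have hL : 0 ≤ L := by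
    have := hlip 0 1; have h0 : (0:ℝ) ≤ ‖g 0 - g 1‖ := norm_nonneg _; norm_num at this; linarith
  have hMg : 0 ≤ Mg := (norm_nonneg _).trans (hbd 0)
  have hK : 0 ≤ 3 * L * r ^ 2 + Mg := by positivity
  have hl : LipschitzWith (Real.toNNReal (3 * L * r ^ 2 + Mg)) (fun e : ℝ => g (k₀ ^ 2 + e ^ 2) * (I * k₀ + e)) :=
    LipschitzWith.of_dist_le_mul fun e e' => by
      rw [dist_eq_norm, Real.dist_eq, Real.coe_toNNReal _ hK]
      have h := klsp_lipschitz hlip hbd hsupp hr k₀ e k₀ e'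
      rwa [sub_self, abs_zero, zero_add] at h
  exact hl.continuous

end Continuity

end Summit.HubbardSuperconductivity.HubbardSuperconductivity.Theorems.KLRegimeSplit

end
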